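import Literature.Barriers.CriticalPhenomena.PositionSpaceRGNonGibbsianStep24
import Literature.Barriers.CriticalPhenomena.PositionSpaceRGNonGibbsianDiluted
import Literature.Probability.LatticeModels.IsingVolumeMonotonicity
import Literature.Probability.LatticeModels.IsingLocalObservableBound
import Literature.Probability.LatticeModels.IsingBoundaryTilt
import Literature.Probability.LatticeModels.FreeStateLimit
import HarnessLib

/-!
# Barrier `PositionSpaceRGNonGibbsian` (van Enter–Fernández–Sokal 1993, Theorem 4.2), layer 5:
# phase selection (Steps 2.1–2.3, `VEFS1993_step2`) from the uniqueness statement of Step 2.2 for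
# the all-`+` image system (`VEFS1993_step22`), proved

Companion file of `Literature/Barriers/CriticalPhenomena/PositionSpaceRGNonGibbsian.lean`, on the
line of Theorem 4.2 (`NonGibbs.VEFS1993_thm42`, the barrier statement; `b = 2`, `d ≥ 3`,
`β > β_c(d-1)`). The chain so far, all proved: `VEFS1993_step2 ∧ VEFS1993_step24 → VEFS1993_eq412
→ VEFS1993_eq413 → VEFS1993_eq432 → VEFS1993_thm42` (`…Selection.lean`, `…Unfixing.lean`,
`…FiniteVolume.lean`, `…Proofs.lean`), with `VEFS1993_step24` proved (`…Step24.lean`). Here the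
phase-selection statement `VEFS1993_step2` (Steps 2.1–2.3 of §4.3.1, in finite volume) is PROVED
from the single infinite-volume input that the printed proof uses: Step 2.2, the uniqueness of the
Gibbs measure of the internal-spin system with ALL image spins `+`, vendored as the named fact
`VEFS1993_step22` in its Lebowitz–Martin-Löf finite-volume form (the `+` and `-` finite-volume
one-point functions have the same limit). Everything else in Steps 2.1–2.3 — the invisibility of
the image spins outside `Λ_{R'}` (2.1), the finite-volume perturbation transferring uniqueness from
the all-`+` image system to `⟨R;∞;Σ;+⟩` (2.2: "changing the image spins inside `Λ_R` amounts to a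
finite-volume perturbation of the system and hence it does not alter the number of Gibbs
measures"), the FKG comparison with the `+` phase of `⟨∞;Σ⟩` (2.3), the cancellation of the
alternating image fields ("precisely the Ising model on a periodically diluted lattice") and the
monotone volume limits — is proved. Nothing is asserted (D-0014): the only unproved declaration is
`def VEFS1993_step22 : Prop`; the file ends with
`VEFS1993_thm42_of_step22 : VEFS1993_step22 → VEFS1993_thm42`.

## What the source prints (arXiv:hep-lat/9210032, §4.3.1, pp. 108–112)

* Step 2 (p. 108–109): the systems `⟨R,R';Σ,+,σ⟩` (internal spins in `Λ^int_{R'}`; image spins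
  `Σ = ω'_alt` in `Λ^image_R`, `+` in the annulus, everything outside `Λ_{R'}` arbitrary),
  `⟨R;∞;Σ;+⟩` (image spins `Σ` in `Λ^image_R` and `+` outside `Λ_R`), `⟨∞;Σ⟩` ("the image spins
  everywhere fixed in the alternating (`Σ`) configuration"). "We shall prove the following:
  Step 2.1) `μ^{Σ,+,σ}_{R,R'}` converges as `R' → ∞` to a Gibbs measure for the system `⟨R;∞;Σ;+⟩`.
  Step 2.2) The system `⟨R;∞;Σ;+⟩` has a unique Gibbs measure, call it `μ^{Σ,+}_{R,∞}`. Step 2.3)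
  The measure `μ^{Σ,+}_{R,∞}` is larger (in FKG sense) than all Gibbs measures for the system
  `⟨∞;Σ⟩`. Step 2.4) …"
* Step 2.1 (p. 110): "for any volume `Λ ⊆ Λ_{R'-1}`, the DLR equations for the systems
  `⟨R,R';Σ,+,σ⟩` and `⟨R;∞;Σ;+⟩` are identical (i.e. the `π_Λ`'s are the same)".
* Step 2.2 (p. 110–111): "First, we notice that it is enough to prove uniqueness of the Gibbs
  measure when all the image spins (including those inside `Λ_R`) are set in the '`+`' position.
  Indeed, changing the image spins inside `Λ_R` amounts to a finite-volume perturbation of the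
  system and hence it does not alter the number of Gibbs measures [157, section 7.4]. [In fact,
  every Gibbs measure `μ'` for the perturbed interaction comes from a uniquely defined Gibbs
  measure `μ` of the unperturbed interaction: if `W` is the perturbation, then
  `μ'(·) = μ(· e^{-W})/μ(e^{-W})`.] To prove the uniqueness of the Gibbs measure for the system with
  all image spins '`+`', we provide two arguments. First argument, proving uniqueness only at low
  temperature: Pirogov–Sinai theory … Second argument, proving uniqueness at all temperatures:
  The internal-spin system is an Ising model on a periodic lattice, with nearest-neighbor
  coupling `J > 0` and a periodic magnetic field … By the Lee–Yang theorem … and a result of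
  Lebowitz and Penrose …, the pressure of such an Ising model is a jointly analytic function of
  `J` and `h` on the domain `J, h > 0`. … (4.28) … (4.29) … we conclude that `μ₋(σ_A) = μ₊(σ_A)`
  (4.30) … hence `μ₋ = μ₊` (4.31). Now by the FKG inequality `μ₋ ≤ ν ≤ μ₊` in FKG sense for every
  Gibbs measure `ν`, hence there is a unique Gibbs measure at all temperatures."; "(We only need
  uniqueness at low enough temperature, but in fact the Gibbs measure is unique at all
  temperatures.)"
* Step 2.3 (p. 111–112): "by the FKG inequality, the finite-volume Gibbs measure for the
  `⟨R;∞;Σ;+⟩` system with any (internal-spin) boundary condition is larger in FKG sense than the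
  finite-volume Gibbs measure for the `⟨∞;Σ⟩` system with the same boundary conditions. This
  inequality passes directly to the infinite-volume limit."; `⟨∞;Σ⟩` "is precisely the Ising
  model on a periodically diluted lattice" (Step 2.4).
* (4.27): "by symmetry"; footnote 48 (p. 99).

## What is formalised (namespace `Literature.Barriers.CriticalPhenomena.NonGibbs`)

* Definitions (image sites are `IsDecimatedSite` of `…Diluted.lean`): `halfSite` (`y/2`),
  `IsAlternating` (patterns with `p(x + e_j) = -p(x)`: `ω'_alt`, `-ω'_alt`),
  `patternBC p` (image spins in the pattern `p`, internal spins `+1`: the `+` boundary condition of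
  `⟨∞;Σ⟩`), `baseBC s` (all image spins `+`, internal spins `s`), `coreSites R` (the image sites
  `2x`, `x ∈ Λ_R`), `phaseBC p R s` (image spins `p` on `Λ_R`, `+` outside, internal spins `s`:
  the `±` boundary conditions of `⟨R;∞;Σ;+⟩`), `coreTilt` / `coreTiltExp` (the perturbation
  `e^{-W}` of Step 2.2 and its exponent bound).
* Named fact (not proved): `VEFS1993_step22` — Step 2.2 for the all-`+` image system: for `d ≥ 3`,
  `β ≥ 0` and every internal site `x`, `⟨σ_x⟩^{baseBC 1}_{Λ^int_{R'}} - ⟨σ_x⟩^{baseBC (-1)}_{Λ^int_{R'}} → 0`.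
* Proved: the cancellation of alternating image fields (`sum_image_nbr_eq_zero`,
  `isingWeight_patternBC_eq_decorated`, `isingExpect_patternBC_eq_decorated`: the decorated `+`
  states are the `+` states of `⟨∞;±Σ⟩`); the perturbation identity
  `isingExpect_phaseBC_eq_div` and the transfer of Step 2.2 `tendsto_isingExpect_phaseBC_sub`;
  the invisibility of the far image spins (`isingExpect_coreAnnulusBC_eq_phaseBC`,
  `isingExpect_neg_coreAnnulusBC_eq_phaseBC`: the two extremal systems of `VEFS1993_eq412` are the
  `-` states of `⟨R;∞;±Σ;+⟩`); and the assembly `exists_forall_sub_le_isingExpect_phaseBC`,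
  `VEFS1993_step2_of_step22 : VEFS1993_step22 → VEFS1993_step2`,
  `VEFS1993_thm42_of_step22 : VEFS1993_step22 → VEFS1993_thm42`, `positionSpaceRGNonGibbsian_of_step22`.

What remains for `VEFS1993_thm42_holds` is exactly `VEFS1993_step22` (uniqueness for the Ising
model on the diluted lattice `ℤ^d ∖ 2ℤ^d` with the image spins frozen to `+`, at all `β ≥ 0`).
-/

noncomputable section

/-! ## Image sites, half-sites, alternating patterns: the cancellation of the image fields -/

namespace Literature.Barriers.CriticalPhenomena.NonGibbs

open MeasureTheory Finset Filter Literature.Probability.LatticeModels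

variable (d : ℕ)

/-- The image coordinate `y/2` of an image site `y = 2x`. [cite: VanenterFernandezSokal1993, §3.1.2 eq. (3.7)] -/
def halfSite (y : Site d) : Site d := fun i => y i / 2

variable {d}

/-- Membership in `gpiVolume'` (the internal sites of the cube). [cite: VanenterFernandezSokal1993, §4.3.1 Step 2] -/
theorem mem_gpiVolume'_iff {L : ℕ} {y : Site d} :
    y ∈ gpiVolume' d L ↔ y ∈ box d (2 * L) ∧ ¬IsDecimatedSite d y := by
  simp [gpiVolume', IsDecimatedSite]

/-- An image site is `2 · (y/2)`. [cite: VanenterFernandezSokal1993, §3.1.2 eq. (3.7)] -/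
theorem two_mul_halfSite {y : Site d} (hy : IsDecimatedSite d y) : (fun i => 2 * halfSite d y i) = y :=
  funext fun k => Int.mul_ediv_cancel' (hy k)

/-- `(2x)/2 = x`. [cite: VanenterFernandezSokal1993, §3.1.2 eq. (3.7)] -/
@[simp] theorem halfSite_two_mul (x : Site d) : halfSite d (fun i => 2 * x i) = x :=
  funext fun i => by simp [halfSite]

/-- `2x` is an image site. [cite: VanenterFernandezSokal1993, §3.1.2 eq. (3.7)] -/
theorem isDecimatedSite_two_mul (x : Site d) : IsDecimatedSite d (fun i => 2 * x i) := fun _ => dvd_mul_right 2 _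

/-- Shifting by `± e_j`: `y - e_j` is an image site iff `y + e_j` is. [folklore] -/
theorem isDecimatedSite_sub_single_iff (y : Site d) (j : Fin d) :
    IsDecimatedSite d (y - Pi.single j 1) ↔ IsDecimatedSite d (y + Pi.single j 1) := by
  constructor
  · intro h i
    have := h i
    by_cases hij : i = j
    · subst hij; simp at this ⊢; omega
    · simpa [Pi.single_apply, hij] using this
  · intro h i
    have := h i
    by_cases hij : i = j
    · subst hij; simp at this ⊢; omega
    · simpa [Pi.single_apply, hij] using this

/-- If `y` is internal and `y + e_j`, `y + e_k` are image sites then `k = j`. [folklore] -/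
theorem eq_of_isDecimatedSite_add_single {y : Site d} (hy : ¬IsDecimatedSite d y) {j k : Fin d}
    (hj : IsDecimatedSite d (y + Pi.single j 1)) (hk : IsDecimatedSite d (y + Pi.single k 1)) : k = j := by
  by_contra hkj
  apply hy
  intro i
  by_cases hij : i = j
  · subst hij
    simpa [Pi.single_apply, hkj] using hk i
  · simpa [Pi.single_apply, hij] using hj i

/-- For an image site `y + e_j`: `(y + e_j)/2 = (y - e_j)/2 + e_j`. [folklore] -/
theorem halfSite_add_single {y : Site d} {j : Fin d} (hj : IsDecimatedSite d (y + Pi.single j 1)) :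
    halfSite d (y + Pi.single j 1) = halfSite d (y - Pi.single j 1) + Pi.single j 1 := by
  funext i
  by_cases hij : i = j
  · subst hij
    have := hj i
    simp [halfSite] at this ⊢
    omega
  · simp [halfSite, hij]

/-- **Alternating patterns**: `p(x + e_j) = -p(x)` for all `x`, `j` (the fully alternating
configuration `ω'_alt` and its flip). [cite: VanenterFernandezSokal1993, eq. (4.2)] -/
def IsAlternating (p : Site d → ℤˣ) : Prop :=
  ∀ (x : Site d) (j : Fin d), p (x + Pi.single j 1) = -p x

/-- `ω'_alt` is alternating. [cite: VanenterFernandezSokal1993, eq. (4.2)] -/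
theorem isAlternating_altConfig : IsAlternating (altConfig d) := by
  intro x j
  have hsum : ∑ i, (x + Pi.single j 1 : Site d) i = (∑ i, x i) + 1 := by
    simp [Finset.sum_add_distrib]
  rw [altConfig_apply, altConfig_apply, hsum, uzpow_add, uzpow_one, mul_neg_one]

/-- `-ω'_alt` is alternating. [cite: VanenterFernandezSokal1993, eq. (4.2)] -/
theorem isAlternating_neg_altConfig : IsAlternating fun x => -altConfig d x :=
  fun x j => by simp only [isAlternating_altConfig x j]

/-- **The image fields cancel** (van Enter–Fernández–Sokal §4.1.2 Step 1: "each internal spin is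
adjacent either to two image spins of opposite sign — in which case the effective magnetic fields
cancel — or else to no image spin"): for an internal site `y` and an alternating pattern `p` of
image spins, `∑_{z ∼ y, z image} p(z/2) = 0`. [cite: VanenterFernandezSokal1993, §4.1.2 Step 1] -/
theorem sum_image_nbr_eq_zero {p : Site d → ℤˣ} (hp : IsAlternating p) {y : Site d}
    (hy : ¬IsDecimatedSite d y) :
    ∑ z ∈ ((zdGraph d).neighborFinset y).filter (IsDecimatedSite d), (((p (halfSite d z)) : ℤ) : ℝ) = 0 := by
  by_cases hex : ∃ j, IsDecimatedSite d (y + Pi.single j 1)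
  · obtain ⟨j, hj⟩ := hex
    have hj' : IsDecimatedSite d (y - Pi.single j 1) := (isDecimatedSite_sub_single_iff y j).2 hj
    -- the image neighbours of `y` are exactly `y ± e_j`
    have hfilter : ((zdGraph d).neighborFinset y).filter (IsDecimatedSite d) =
        {y + Pi.single j 1, y - Pi.single j 1} := by
      ext z
      simp only [Finset.mem_filter, SimpleGraph.mem_neighborFinset, zdGraph_adj_iff,
        Finset.mem_insert, Finset.mem_singleton]
      constructor
      · rintro ⟨⟨k, hk | hk⟩, hz⟩
        · have hzk : z = y + Pi.single k 1 := hk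
          rw [hzk] at hz
          rw [eq_of_isDecimatedSite_add_single hy hj hz] at hzk
          exact Or.inl hzk
        · have hzk : z = y - Pi.single k 1 := eq_sub_of_add_eq hk.symm
          rw [hzk] at hz
          rw [eq_of_isDecimatedSite_add_single hy hj ((isDecimatedSite_sub_single_iff y k).1 hz)] at hzk
          exact Or.inr hzk
      · rintro (rfl | rfl)
        · exact ⟨⟨j, Or.inl rfl⟩, hj⟩
        · exact ⟨⟨j, Or.inr (sub_add_cancel y _).symm⟩, hj'⟩
    have hne : y + Pi.single j 1 ≠ y - Pi.single j 1 := by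
      intro h
      have := congr_fun h j
      simp at this
      omega
    rw [hfilter, Finset.sum_pair hne, halfSite_add_single hj, hp]
    push_cast [Units.val_neg]
    ring
  · -- no image neighbour at all
    have hfilter : ((zdGraph d).neighborFinset y).filter (IsDecimatedSite d) = ∅ := by
      refine Finset.eq_empty_iff_forall_notMem.2 fun z hz => ?_
      simp only [Finset.mem_filter, SimpleGraph.mem_neighborFinset, zdGraph_adj_iff] at hz
      obtain ⟨⟨k, hk | hk⟩, hzimg⟩ := hz
      · exact hex ⟨k, hk ▸ hzimg⟩
      · have hzk : z = y - Pi.single k 1 := eq_sub_of_add_eq hk.symm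
        exact hex ⟨k, (isDecimatedSite_sub_single_iff y k).1 (hzk ▸ hzimg)⟩
    rw [hfilter, Finset.sum_empty]

end Literature.Barriers.CriticalPhenomena.NonGibbs



/-! ## The decorated `+` states are the internal-spin systems with alternating image spins -/

namespace Literature.Barriers.CriticalPhenomena.NonGibbs

open MeasureTheory Finset Filter Literature.Probability.LatticeModels

variable (d : ℕ)

/-- The boundary condition "image spins in the pattern `p`, internal spins `+1`": for
`p = ω'_alt` the configuration `ξ⁺` whose finite-volume Gibbs measures on internal volumes are the
`+` states of the system `⟨∞;Σ⟩` ("the image spins everywhere fixed in the alternating (`Σ`)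
configuration", van Enter–Fernández–Sokal §4.3.1 Step 2). [cite: VanenterFernandezSokal1993, §4.3.1 Step 2] -/
def patternBC (p : Site d → ℤˣ) : SpinConfig (Site d) :=
  fun y => if IsDecimatedSite d y then p (halfSite d y) else 1

variable {d}

/-- `patternBC` at an internal site. [cite: VanenterFernandezSokal1993, §4.3.1 Step 2] -/
theorem patternBC_of_not_isDecimatedSite (p : Site d → ℤˣ) {y : Site d} (hy : ¬IsDecimatedSite d y) :
    patternBC d p y = 1 := by simp [patternBC, hy]

/-- `patternBC` at an image site. [cite: VanenterFernandezSokal1993, §4.3.1 Step 2] -/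
theorem patternBC_of_isDecimatedSite (p : Site d → ℤˣ) {y : Site d} (hy : IsDecimatedSite d y) :
    patternBC d p y = p (halfSite d y) := by simp [patternBC, hy]

/-- The decorated lattice is a subgraph of `ℤ^d`. [cite: VanenterFernandezSokal1993, §4.1.2 Step 1] -/
theorem decoratedGraph_le : decoratedGraph d ≤ zdGraph d := fun _ _ h => h.1

/-- Adjacency in the decorated lattice, in terms of `IsDecimatedSite`. [cite: VanenterFernandezSokal1993, §4.1.2 Step 1] -/
theorem decoratedGraph_adj {x y : Site d} :
    (decoratedGraph d).Adj x y ↔ (zdGraph d).Adj x y ∧ ¬IsDecimatedSite d x ∧ ¬IsDecimatedSite d y := Iff.rfl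

/-- The edges of `ℤ^d` touching an internal volume `Λ` that are not edges of the decorated lattice
are the bonds `{y, z}` from a site `y ∈ Λ` to an image neighbour `z`.
[cite: VanenterFernandezSokal1993, §4.1.2 Step 1] -/
theorem edgesTouching_sdiff_decorated_eq {Λ : Finset (Site d)} (hΛ : ∀ y ∈ Λ, ¬IsDecimatedSite d y) :
    edgesTouching (zdGraph d) Λ \ edgesTouching (decoratedGraph d) Λ =
      Λ.biUnion fun y => (((zdGraph d).neighborFinset y).filter (IsDecimatedSite d)).image fun z => s(y, z) := by
  ext e
  simp only [Finset.mem_sdiff, mem_edgesTouching_iff, Finset.mem_biUnion, Finset.mem_image,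
    Finset.mem_filter, SimpleGraph.mem_neighborFinset]
  constructor
  · rintro ⟨⟨he, x, hx, hxe⟩, hnot⟩
    induction e using Sym2.ind with
    | _ a b =>
      have hadj : (zdGraph d).Adj a b := (SimpleGraph.mem_edgeSet _).1 he
      -- some endpoint is an image site, since `e` is not a decorated edge
      have himg : IsDecimatedSite d a ∨ IsDecimatedSite d b := by
        by_contra hcon
        push Not at hcon
        exact hnot ⟨(SimpleGraph.mem_edgeSet _).2 ⟨hadj, hcon.1, hcon.2⟩, x, hx, hxe⟩
      rcases Sym2.mem_iff.1 hxe with rfl | rfl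
      · have hb : IsDecimatedSite d b := himg.resolve_left (hΛ _ hx)
        exact ⟨_, hx, b, ⟨hadj, hb⟩, rfl⟩
      · have ha : IsDecimatedSite d a := himg.resolve_right (hΛ _ hx)
        exact ⟨_, hx, a, ⟨hadj.symm, ha⟩, Sym2.eq_swap⟩
  · rintro ⟨y, hy, z, ⟨hadj, hz⟩, rfl⟩
    refine ⟨⟨(SimpleGraph.mem_edgeSet _).2 hadj, y, hy, Sym2.mem_mk_left y z⟩, ?_⟩
    rintro ⟨he, -⟩
    exact ((SimpleGraph.mem_edgeSet _).1 he).2.2 hz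

/-- **The image bonds carry no energy in total** when the image spins follow an alternating
pattern: for an internal volume `Λ`, the configuration `σ` glued into `patternBC d p`, and every
`τ`, `∑_{y ∈ Λ} ∑_{z ∼ y image} σ_y σ_z = 0` — "the effective magnetic fields cancel".
[cite: VanenterFernandezSokal1993, §4.1.2 Step 1] -/
theorem sum_imageBonds_eq_zero {p : Site d → ℤˣ} (hp : IsAlternating p) {Λ : Finset (Site d)}
    (hΛ : ∀ y ∈ Λ, ¬IsDecimatedSite d y) (τ : Λ → ℤˣ) :
    ∑ e ∈ edgesTouching (zdGraph d) Λ \ edgesTouching (decoratedGraph d) Λ,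
      bondSpin (glue Λ τ (.fixed (patternBC d p))) e = 0 := by
  set σ := glue Λ τ (.fixed (patternBC d p)) with hσ
  rw [edgesTouching_sdiff_decorated_eq hΛ, Finset.sum_biUnion]
  · refine Finset.sum_eq_zero fun y hy => ?_
    rw [Finset.sum_image]
    · have hz : ∀ z ∈ ((zdGraph d).neighborFinset y).filter (IsDecimatedSite d),
          bondSpin σ s(y, z) = spinAt y σ * (((p (halfSite d z)) : ℤ) : ℝ) := by
        intro z hz
        have hzimg : IsDecimatedSite d z := (Finset.mem_filter.1 hz).2
        have hzΛ : z ∉ Λ := fun h => hΛ z h hzimg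
        rw [bondSpin_mk]
        congr 1
        simp only [spinAt, hσ, glue_apply_of_notMem _ _ _ hzΛ, BoundaryCondition.outside_fixed,
          patternBC_of_isDecimatedSite p hzimg]
      rw [Finset.sum_congr rfl hz, ← Finset.mul_sum, sum_image_nbr_eq_zero hp (hΛ y hy), mul_zero]
    · intro z _ z' _ h
      exact Sym2.congr_right.1 h
  · -- the bond families of distinct internal sites are disjoint
    intro y hy y' hy' hne
    simp only [Function.onFun]
    rw [Finset.disjoint_left]
    intro e he he'
    obtain ⟨z, hz, rfl⟩ := Finset.mem_image.1 he
    obtain ⟨z', hz', heq⟩ := Finset.mem_image.1 he'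
    rcases Sym2.eq_iff.1 heq with ⟨h1, -⟩ | ⟨h1, -⟩
    · exact hne h1.symm
    · refine hΛ y' (Finset.mem_coe.1 hy') ?_
      rw [h1]
      exact (Finset.mem_filter.1 hz).2

/-- **The Boltzmann weights agree**: on an internal volume, the zero-field `ℤ^d` weights with
the image spins frozen in an alternating pattern (and `+1` internal boundary spins) are the
zero-field weights of the decorated lattice with `+` boundary condition.
[cite: VanenterFernandezSokal1993, §4.1.2 Step 1] -/
theorem isingWeight_patternBC_eq_decorated {p : Site d → ℤˣ} (hp : IsAlternating p)
    {Λ : Finset (Site d)} (hΛ : ∀ y ∈ Λ, ¬IsDecimatedSite d y) (β : ℝ) (τ : Λ → ℤˣ) :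
    isingWeight (zdGraph d) Λ β 0 (.fixed (patternBC d p)) τ =
      isingWeight (decoratedGraph d) Λ β 0 .plus τ := by
  set σ := glue Λ τ (.fixed (patternBC d p)) with hσ
  set σ' := glue Λ τ (.plus : BoundaryCondition (Site d)) with hσ'
  -- the two glued configurations agree at internal sites
  have hagree : ∀ x, ¬IsDecimatedSite d x → σ x = σ' x := by
    intro x hx
    by_cases hxΛ : x ∈ Λ
    · rw [hσ, hσ', glue_apply_of_mem _ _ _ hxΛ, glue_apply_of_mem _ _ _ hxΛ]
    · rw [hσ, hσ', glue_apply_of_notMem _ _ _ hxΛ, glue_apply_of_notMem _ _ _ hxΛ,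
        BoundaryCondition.outside_fixed, patternBC_of_not_isDecimatedSite p hx]
      rfl
  have hsub : edgesTouching (decoratedGraph d) Λ ⊆ edgesTouching (zdGraph d) Λ := fun e he => by
    rw [mem_edgesTouching_iff] at he ⊢
    exact ⟨SimpleGraph.edgeSet_subset_edgeSet.2 decoratedGraph_le he.1, he.2⟩
  have hdec : ∀ e ∈ edgesTouching (decoratedGraph d) Λ, bondSpin σ e = bondSpin σ' e := by
    intro e he
    have he' := (mem_edgesTouching_iff.1 he).1
    induction e using Sym2.ind with
    | _ a b =>
      have hab := (SimpleGraph.mem_edgeSet _).1 he'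
      simp only [bondSpin_mk, spinAt, hagree a hab.2.1, hagree b hab.2.2]
  rw [isingWeight, isingWeight]
  congr 1
  have hE : interactionEdges (zdGraph d) Λ (.fixed (patternBC d p)) = edgesTouching (zdGraph d) Λ := rfl
  have hE' : interactionEdges (decoratedGraph d) Λ .plus = edgesTouching (decoratedGraph d) Λ := rfl
  simp only [isingHamiltonian, hE, hE', zero_mul, sub_zero]
  rw [← hσ, ← hσ', ← Finset.sum_sdiff hsub, sum_imageBonds_eq_zero hp hΛ τ, zero_add,
    Finset.sum_congr rfl hdec]

/-- **The decorated `+` states are the internal-spin systems with alternating image spins**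
(van Enter–Fernández–Sokal §4.1.2 Step 1 / §4.3.1 Step 2, `⟨∞;Σ⟩` is "precisely the Ising model
on a periodically diluted lattice"): for an alternating image pattern `p` (`ω'_alt` or `-ω'_alt`),
an internal volume `Λ` and an observable reading only the spins of `Λ`,
`⟨f⟩^{ξ_p}_{Λ;β,0}(ℤ^d) = ⟨f⟩⁺_{Λ;β,0}(dec)`. [cite: VanenterFernandezSokal1993, §4.1.2 Step 1 and §4.3.1 Step 2] -/
theorem isingExpect_patternBC_eq_decorated {p : Site d → ℤˣ} (hp : IsAlternating p)
    {Λ : Finset (Site d)} (hΛ : ∀ y ∈ Λ, ¬IsDecimatedSite d y) (β : ℝ) {f : SpinConfig (Site d) → ℝ}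
    (hfm : Measurable f) (hf : ∀ σ σ' : SpinConfig (Site d), (∀ x ∈ Λ, σ x = σ' x) → f σ = f σ') :
    isingExpect (zdGraph d) Λ β 0 (.fixed (patternBC d p)) f =
      isingExpect (decoratedGraph d) Λ β 0 .plus f := by
  have hval : ∀ τ : Λ → ℤˣ, f (glue Λ τ (.fixed (patternBC d p))) = f (glue Λ τ .plus) :=
    fun τ => hf _ _ fun x hx => by rw [glue_apply_of_mem _ _ _ hx, glue_apply_of_mem _ _ _ hx]
  rw [isingExpect_eq_sum_div (zdGraph d) Λ 0 _ β hfm, isingExpect_eq_sum_div (decoratedGraph d) Λ 0 _ β hfm,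
    isingPartitionFunction, isingPartitionFunction]
  simp only [isingWeight_patternBC_eq_decorated hp hΛ β, hval]

end Literature.Barriers.CriticalPhenomena.NonGibbs


/-! ## The boundary conditions of the internal-spin systems `⟨R;∞;Σ;+⟩` and of the all-`+` image
system; the named fact Step 2.2 -/

namespace Literature.Barriers.CriticalPhenomena.NonGibbs

open MeasureTheory Finset Filter Topology Literature.Probability.LatticeModels

variable (d : ℕ)

/-- **All image spins `+`, internal boundary spins `s`** (van Enter–Fernández–Sokal §4.3.1 Step 2.2:
"it is enough to prove uniqueness of the Gibbs measure when all the image spins (including those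
inside `Λ_R`) are set in the '`+`' position"; `s = ±1` are the `±` boundary conditions of that
internal-spin system). [cite: VanenterFernandezSokal1993, §4.3.1 Step 2.2] -/
def baseBC (s : ℤˣ) : SpinConfig (Site d) := fun y => if IsDecimatedSite d y then 1 else s

/-- The image sites `2x`, `x ∈ Λ_R = box d R` (the finitely many image spins whose values
distinguish `⟨R;∞;Σ;+⟩` from the all-`+` image system). [cite: VanenterFernandezSokal1993, §4.3.1 Step 2.2] -/
def coreSites (R : ℕ) : Finset (Site d) := (box d R).image fun x => fun i => 2 * x i

/-- **The boundary conditions of `⟨R;∞;Σ;+⟩` with internal boundary spins `s`**: image spins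
`p(x)` at `2x`, `x ∈ Λ_R` (pattern `p = ω'_alt`, or `-ω'_alt` for the flipped (4.27) system),
`+1` at the other image sites, `s` at the internal sites ("the image spins in `Λ^image_R` fixed in
the alternating (`Σ`) configuration and the image spins outside `Λ_R` fixed to be all `+`",
§4.3.1 Step 2; `s = ±1`: its `±` finite-volume states). [cite: VanenterFernandezSokal1993, §4.3.1 Step 2 (the system ⟨R;∞;Σ;+⟩)] -/
def phaseBC (p : Site d → ℤˣ) (R : ℕ) (s : ℤˣ) : SpinConfig (Site d) :=
  fun y => if IsDecimatedSite d y then (if halfSite d y ∈ box d R then p (halfSite d y) else 1) else s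

/-- **van Enter–Fernández–Sokal 1993, §4.3.1 Step 2.2 (uniqueness for the all-`+` image system),
in the Lebowitz–Martin-Löf finite-volume form.** "First, we notice that it is enough to prove
uniqueness of the Gibbs measure when all the image spins (including those inside `Λ_R`) are set in
the '`+`' position. … To prove the uniqueness of the Gibbs measure for the system with all image
spins '`+`', we provide two arguments. First argument, proving uniqueness only at low temperature:
Pirogov–Sinai theory … Second argument, proving uniqueness at all temperatures: The internal-spin
system is an Ising model on a periodic lattice, with nearest-neighbor coupling `J > 0` and a
periodic magnetic field … By the Lee–Yang theorem … and a result of Lebowitz and Penrose …, it can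
be shown that the pressure of such an Ising model is a jointly analytic function of `J` and `h` on
the domain `J, h > 0`. … From (4.28) and (4.29) we conclude that `μ₋(σ_A) = μ₊(σ_A)` (4.30) … hence
`μ₋ = μ₊` (4.31). Now by the FKG inequality `μ₋ ≤ ν ≤ μ₊` in FKG sense for every Gibbs measure `ν`,
hence there is a unique Gibbs measure at all temperatures." (p. 110–111; "(We only need uniqueness
at low enough temperature, but in fact the Gibbs measure is unique at all temperatures.)")
Transcription: for `d ≥ 3`, `β ≥ 0` and every internal site `x`, the one-point functions of the
`+` and `-` finite-volume states of the internal-spin system with all image spins `+` (boundary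
conditions `baseBC d 1` and `baseBC d (-1)`, volumes `Λ^int_{R'} = gpiVolume' d R'`) have the same
limit: `⟨σ_x⟩^{+}_{Λ^int_{R'}} - ⟨σ_x⟩^{-}_{Λ^int_{R'}} → 0` as `R' → ∞` — equality of the `±` phases'
magnetisations, equivalent to `μ₋ = μ₊` by the FKG sandwich. Named fact, not proved here.
[cite: VanenterFernandezSokal1993, §4.3.1 Step 2.2, eqs. (4.28)–(4.31)] -/
def VEFS1993_step22 : Prop :=
  ∀ d : ℕ, 3 ≤ d → ∀ β : ℝ, 0 ≤ β → ∀ x : Site d, ¬IsDecimatedSite d x →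
    Tendsto (fun R' : ℕ =>
      isingExpect (zdGraph d) (gpiVolume' d R') β 0 (.fixed (baseBC d 1)) (spinAt x) -
        isingExpect (zdGraph d) (gpiVolume' d R') β 0 (.fixed (baseBC d (-1))) (spinAt x))
      atTop (𝓝 0)

variable {d}

/-! ### Basic properties of the boundary conditions and volumes -/

/-- Membership in `coreSites`. [cite: VanenterFernandezSokal1993, §4.3.1 Step 2.2] -/
theorem mem_coreSites_iff {R : ℕ} {y : Site d} :
    y ∈ coreSites d R ↔ IsDecimatedSite d y ∧ halfSite d y ∈ box d R := by
  constructor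
  · intro hy
    obtain ⟨x, hx, rfl⟩ := Finset.mem_image.1 hy
    exact ⟨isDecimatedSite_two_mul x, by simpa using hx⟩
  · rintro ⟨himg, hbox⟩
    exact Finset.mem_image.2 ⟨halfSite d y, hbox, two_mul_halfSite himg⟩

/-- `phaseBC` is the all-`+`-image boundary condition changed on the core image sites.
[cite: VanenterFernandezSokal1993, §4.3.1 Step 2.2] -/
theorem phaseBC_eq_piecewise (p : Site d → ℤˣ) (R : ℕ) (s : ℤˣ) :
    phaseBC d p R s = fun y => if y ∈ coreSites d R then p (halfSite d y) else baseBC d s y := by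
  funext y
  simp only [phaseBC, baseBC, mem_coreSites_iff]
  by_cases himg : IsDecimatedSite d y <;> by_cases hbox : halfSite d y ∈ box d R <;> simp [himg, hbox]

/-- `phaseBC` at an internal site. [cite: VanenterFernandezSokal1993, §4.3.1 Step 2] -/
theorem phaseBC_of_not_isDecimatedSite (p : Site d → ℤˣ) (R : ℕ) (s : ℤˣ) {y : Site d} (hy : ¬IsDecimatedSite d y) :
    phaseBC d p R s y = s := by simp [phaseBC, hy]

/-- `baseBC` at an internal site. [cite: VanenterFernandezSokal1993, §4.3.1 Step 2.2] -/
theorem baseBC_of_not_isDecimatedSite (s : ℤˣ) {y : Site d} (hy : ¬IsDecimatedSite d y) : baseBC d s y = s := by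
  simp [baseBC, hy]

/-- `baseBC d (-1) ≤ baseBC d 1`. [cite: VanenterFernandezSokal1993, §4.3.1 Step 2.2] -/
theorem baseBC_neg_one_le_one : baseBC d (-1) ≤ baseBC d 1 := fun y => by
  by_cases hy : IsDecimatedSite d y <;> simp [baseBC, hy, neg_one_le_intUnits]

/-- `phaseBC d p R (-1) ≤ phaseBC d p R 1`. [cite: VanenterFernandezSokal1993, §4.3.1 Step 2] -/
theorem phaseBC_neg_one_le_one (p : Site d → ℤˣ) (R : ℕ) : phaseBC d p R (-1) ≤ phaseBC d p R 1 :=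
  fun y => by
    by_cases hy : IsDecimatedSite d y
    · simp [phaseBC, hy]
    · simp [phaseBC, hy, neg_one_le_intUnits]

/-- The `+`-image pattern lies below `phaseBC d p R 1`: `patternBC d p ≤ phaseBC d p R 1`
(raising the image spins outside `Λ_R` from the pattern to `+`; Step 2.3: "`μ^{Σ,+}_{R,∞}` is
larger (in FKG sense)"). [cite: VanenterFernandezSokal1993, §4.3.1 Step 2.3] -/
theorem patternBC_le_phaseBC_one (p : Site d → ℤˣ) (R : ℕ) : patternBC d p ≤ phaseBC d p R 1 :=
  fun y => by
    by_cases hy : IsDecimatedSite d y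
    · by_cases hbox : halfSite d y ∈ box d R
      · simp [patternBC, phaseBC, hy, hbox]
      · simp [patternBC, phaseBC, hy, hbox, intUnits_le_one]
    · simp [patternBC, phaseBC, hy]

/-- The internal cubes are nested. [cite: VanenterFernandezSokal1993, §4.3.1 Step 2] -/
theorem gpiVolume'_mono {L L' : ℕ} (h : L ≤ L') : gpiVolume' d L ⊆ gpiVolume' d L' := by
  intro y hy
  rw [mem_gpiVolume'_iff] at hy ⊢
  exact ⟨box_mono d (Nat.mul_le_mul_left 2 h) hy.1, hy.2⟩

/-- A neighbour of a site of `box d (2R)` with even coordinates has its half in `box d R`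
(image sites adjacent to the cube `Λ_{R'}` lie in it). [cite: VanenterFernandezSokal1993, §4.3.1 Step 2] -/
theorem halfSite_mem_box_of_adj {R : ℕ} {x y : Site d} (hx : x ∈ box d (2 * R))
    (hxy : (zdGraph d).Adj x y) (hy : IsDecimatedSite d y) : halfSite d y ∈ box d R := by
  rw [mem_box] at hx ⊢
  intro i
  obtain ⟨j, h | h⟩ := (zdGraph_adj_iff x y).1 hxy <;>
  · have hxi := hx i
    have hyi := hy i
    have hcoord := congr_fun h i
    simp only [Pi.add_apply, Pi.single_apply] at hcoord
    simp only [halfSite]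
    split_ifs at hcoord <;> push_cast at hxi ⊢ <;> omega

/-- The neighbours of a core image site lie in every internal cube `Λ^int_{R'}`, `R' ≥ R + 1`.
[cite: VanenterFernandezSokal1993, §4.3.1 Step 2.2] -/
theorem neighborFinset_subset_gpiVolume' {R R' : ℕ} (hR : R + 1 ≤ R') {z : Site d}
    (hz : z ∈ coreSites d R) : (zdGraph d).neighborFinset z ⊆ gpiVolume' d R' := by
  intro y hy
  rw [SimpleGraph.mem_neighborFinset] at hy
  obtain ⟨hzimg, hzbox⟩ := mem_coreSites_iff.1 hz
  rw [mem_gpiVolume'_iff]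
  obtain ⟨j, h | h⟩ := (zdGraph_adj_iff z y).1 hy
  · constructor
    · rw [mem_box] at hzbox ⊢
      intro i
      have := hzbox i
      have hzi := hzimg i
      rw [h]
      simp only [halfSite] at this
      simp only [Pi.add_apply, Pi.single_apply]
      split_ifs <;> push_cast <;> omega
    · intro hyimg
      have h1 := hyimg j
      have h2 := hzimg j
      rw [h] at h1
      simp at h1
      omega
  · have hy' : y = z - Pi.single j 1 := eq_sub_of_add_eq h.symm
    constructor
    · rw [mem_box] at hzbox ⊢
      intro i
      have := hzbox i
      have hzi := hzimg i
      rw [hy']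
      simp only [halfSite] at this
      simp only [Pi.sub_apply, Pi.single_apply]
      split_ifs <;> push_cast <;> omega
    · intro hyimg
      have h1 := hyimg j
      have h2 := hzimg j
      rw [hy'] at h1
      simp at h1
      omega

/-- Core image sites are not internal. [cite: VanenterFernandezSokal1993, §4.3.1 Step 2.2] -/
theorem not_mem_gpiVolume'_of_mem_coreSites {R L : ℕ} {z : Site d} (hz : z ∈ coreSites d R) :
    z ∉ gpiVolume' d L := fun h => not_isDecimatedSite_of_mem_gpiVolume' h (mem_coreSites_iff.1 hz).1

/-- For `R' ≥ R + 1` the neighbour sum of a core image site inside `Λ^int_{R'}` is the fixed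
observable `∑_{y ∼ z} σ_y`. [cite: VanenterFernandezSokal1993, §4.3.1 Step 2.2] -/
theorem nbrSum_gpiVolume'_eq {R R' : ℕ} (hR : R + 1 ≤ R') {z : Site d} (hz : z ∈ coreSites d R) :
    nbrSum (zdGraph d) (gpiVolume' d R') z = spinTotal ((zdGraph d).neighborFinset z) := by
  rw [nbrSum_eq_spinTotal]
  congr 1
  exact Finset.inter_eq_right.2 (neighborFinset_subset_gpiVolume' hR hz)

end Literature.Barriers.CriticalPhenomena.NonGibbs


/-! ## Step 2.2 transferred to `⟨R;∞;Σ;+⟩`: the `±` states of the perturbed system merge -/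

namespace Literature.Barriers.CriticalPhenomena.NonGibbs

open MeasureTheory Finset Filter Topology Literature.Probability.LatticeModels

variable {d : ℕ}

/-- Elementary: a bound on the difference of two ratios with denominators bounded below.
[cite: VanenterFernandezSokal1993, §4.3.1 Step 2.2 (perturbation μ'(·) = μ(·e^{-W})/μ(e^{-W}))] -/
theorem abs_div_sub_div_le_of_le {a a' b b' m K L : ℝ} (hm : 0 < m) (hb : m ≤ b) (hb' : m ≤ b')
    (ha' : |a'| ≤ K) (hL : |b'| ≤ L) :
    |a / b - a' / b'| ≤ (|a - a'| * L + K * |b - b'|) / m ^ 2 := by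
  have hb0 : 0 < b := hm.trans_le hb
  have hb'0 : 0 < b' := hm.trans_le hb'
  have hK : 0 ≤ K := (abs_nonneg _).trans ha'
  have hL0 : 0 ≤ L := (abs_nonneg _).trans hL
  rw [div_sub_div _ _ hb0.ne' hb'0.ne', abs_div, abs_mul, abs_of_pos hb0, abs_of_pos hb'0]
  have hnum : |a * b' - b * a'| ≤ |a - a'| * L + K * |b - b'| := by
    have : a * b' - b * a' = (a - a') * b' + a' * (b' - b) := by ring
    rw [this]
    calc |(a - a') * b' + a' * (b' - b)| ≤ |(a - a') * b'| + |a' * (b' - b)| := abs_add_le _ _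
      _ = |a - a'| * |b'| + |a'| * |b - b'| := by rw [abs_mul, abs_mul, abs_sub_comm b' b]
      _ ≤ |a - a'| * L + K * |b - b'| := by
          gcongr
  have hden : m ^ 2 ≤ b * b' := by nlinarith
  calc |a * b' - b * a'| / (b * b') ≤ (|a - a'| * L + K * |b - b'|) / (b * b') :=
        div_le_div_of_nonneg_right hnum (by positivity)
    _ ≤ (|a - a'| * L + K * |b - b'|) / m ^ 2 :=
        div_le_div_of_nonneg_left (by positivity) (by positivity) hden

/-- The neighbours of an image site are internal. [cite: VanenterFernandezSokal1993, §4.1.2 Step 1] -/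
theorem not_isDecimatedSite_of_adj {z y : Site d} (hz : IsDecimatedSite d z) (hzy : (zdGraph d).Adj z y) :
    ¬IsDecimatedSite d y := by
  obtain ⟨j, h | h⟩ := (zdGraph_adj_iff z y).1 hzy
  · intro hy
    have h1 := hy j; have h2 := hz j
    rw [h] at h1; simp at h1; omega
  · intro hy
    have h1 := hy j; have h2 := hz j
    have hy' : y = z - Pi.single j 1 := eq_sub_of_add_eq h.symm
    rw [hy'] at h1; simp at h1; omega

/-- **The perturbation tilt** distinguishing `⟨R;∞;p;+⟩` from the all-`+` image system:
`T_p,R(σ) = ∏_{z = 2x, x ∈ Λ_R} exp(β (p(x) - 1) ∑_{y ∼ z} σ_y)` — a positive bounded local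
observable of the internal spins next to the core image sites ("changing the image spins inside
`Λ_R` amounts to a finite-volume perturbation of the system … `μ'(·) = μ(· e^{-W})/μ(e^{-W})`",
§4.3.1 Step 2.2). [cite: VanenterFernandezSokal1993, §4.3.1 Step 2.2] -/
def coreTilt (d : ℕ) (β : ℝ) (p : Site d → ℤˣ) (R : ℕ) (σ : SpinConfig (Site d)) : ℝ :=
  ∏ z ∈ coreSites d R, Real.exp (β * ((((p (halfSite d z) : ℤ) : ℝ) - 1) *
    spinTotal ((zdGraph d).neighborFinset z) σ))

/-- `coreTilt` is measurable. [cite: VanenterFernandezSokal1993, §4.3.1 Step 2.2] -/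
theorem measurable_coreTilt (β : ℝ) (p : Site d → ℤˣ) (R : ℕ) : Measurable (coreTilt d β p R) :=
  Finset.measurable_prod _ fun _ _ =>
    Real.measurable_exp.comp (((measurable_spinTotal _).const_mul _).const_mul _)

/-- `coreTilt` is positive. [cite: VanenterFernandezSokal1993, §4.3.1 Step 2.2] -/
theorem coreTilt_pos (β : ℝ) (p : Site d → ℤˣ) (R : ℕ) (σ : SpinConfig (Site d)) :
    0 < coreTilt d β p R σ :=
  Finset.prod_pos fun _ _ => Real.exp_pos _

/-- The exponent bound constant of `coreTilt`. [cite: VanenterFernandezSokal1993, §4.3.1 Step 2.2] -/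
def coreTiltExp (d : ℕ) (β : ℝ) (R : ℕ) : ℝ :=
  ∑ z ∈ coreSites d R, 2 * |β| * #((zdGraph d).neighborFinset z)

/-- Two-sided bounds `e^{-K} ≤ T ≤ e^{K}` for the perturbation tilt.
[cite: VanenterFernandezSokal1993, §4.3.1 Step 2.2] -/
theorem coreTilt_mem_Icc (β : ℝ) (p : Site d → ℤˣ) (R : ℕ) (σ : SpinConfig (Site d)) :
    Real.exp (-coreTiltExp d β R) ≤ coreTilt d β p R σ ∧
      coreTilt d β p R σ ≤ Real.exp (coreTiltExp d β R) := by
  have hterm : ∀ z ∈ coreSites d R,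
      |β * ((((p (halfSite d z) : ℤ) : ℝ) - 1) * spinTotal ((zdGraph d).neighborFinset z) σ)| ≤
        2 * |β| * #((zdGraph d).neighborFinset z) := by
    intro z _
    have hS := abs_spinTotal_le ((zdGraph d).neighborFinset z) σ
    have hp : |(((p (halfSite d z) : ℤ) : ℝ) - 1)| ≤ 2 := by
      rcases Int.units_eq_one_or (p (halfSite d z)) with h | h <;> norm_num [h]
    rw [abs_mul, abs_mul]
    calc |β| * (|(((p (halfSite d z) : ℤ) : ℝ) - 1)| * |spinTotal ((zdGraph d).neighborFinset z) σ|)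
        ≤ |β| * (2 * #((zdGraph d).neighborFinset z)) := by
          refine mul_le_mul_of_nonneg_left ?_ (abs_nonneg β)
          exact mul_le_mul hp hS (abs_nonneg _) (by norm_num)
      _ = 2 * |β| * #((zdGraph d).neighborFinset z) := by ring
  unfold coreTilt coreTiltExp
  constructor
  · rw [← Finset.sum_neg_distrib, Real.exp_sum]
    refine Finset.prod_le_prod (fun _ _ => (Real.exp_pos _).le) fun z hz => Real.exp_le_exp.2 ?_
    linarith [neg_abs_le (β * ((((p (halfSite d z) : ℤ) : ℝ) - 1) *
      spinTotal ((zdGraph d).neighborFinset z) σ)), hterm z hz]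
  · rw [Real.exp_sum]
    refine Finset.prod_le_prod (fun _ _ => (Real.exp_pos _).le) fun z hz => Real.exp_le_exp.2 ?_
    linarith [le_abs_self (β * ((((p (halfSite d z) : ℤ) : ℝ) - 1) *
      spinTotal ((zdGraph d).neighborFinset z) σ)), hterm z hz]

/-- `coreTilt` depends only on the spins next to the core image sites.
[cite: VanenterFernandezSokal1993, §4.3.1 Step 2.2] -/
theorem dependsOn_coreTilt (β : ℝ) (p : Site d → ℤˣ) (R : ℕ) :
    DependsOn (coreTilt d β p R)
      (↑((coreSites d R).biUnion fun z => (zdGraph d).neighborFinset z) : Set (Site d)) := by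
  intro σ τ h
  unfold coreTilt
  refine Finset.prod_congr rfl fun z hz => ?_
  rw [spinTotal_congr ((zdGraph d).neighborFinset z) (σ := σ) (σ' := τ) fun x hx =>
    h x (Finset.mem_coe.2 (Finset.mem_biUnion.2 ⟨z, hz, hx⟩))]

/-- **The `±` states of `⟨R;∞;p;+⟩` as tilted `±` states of the all-`+` image system**: for
`R' ≥ R + 1` and an observable `f` reading only the spins of `Λ^int_{R'}`,
`⟨f⟩^{phaseBC p R s}_{Λ^int_{R'}} = ⟨f T⟩^{baseBC s}_{Λ^int_{R'}} / ⟨T⟩^{baseBC s}_{Λ^int_{R'}}` with `T = coreTilt`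
("every Gibbs measure `μ'` for the perturbed interaction comes from a uniquely defined Gibbs
measure `μ` of the unperturbed interaction: if `W` is the perturbation, then
`μ'(·) = μ(· e^{-W})/μ(e^{-W})`", §4.3.1 Step 2.2, in finite volume).
[cite: VanenterFernandezSokal1993, §4.3.1 Step 2.2] -/
theorem isingExpect_phaseBC_eq_div (β : ℝ) (p : Site d → ℤˣ) {R R' : ℕ} (hR : R + 1 ≤ R') (s : ℤˣ)
    {f : SpinConfig (Site d) → ℝ} (hfm : Measurable f)
    (hf : ∀ σ σ' : SpinConfig (Site d), (∀ x ∈ gpiVolume' d R', σ x = σ' x) → f σ = f σ') :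
    isingExpect (zdGraph d) (gpiVolume' d R') β 0 (.fixed (phaseBC d p R s)) f =
      isingExpect (zdGraph d) (gpiVolume' d R') β 0 (.fixed (baseBC d s))
          (fun σ => f σ * coreTilt d β p R σ) /
        isingExpect (zdGraph d) (gpiVolume' d R') β 0 (.fixed (baseBC d s)) (coreTilt d β p R) := by
  have hZ : ∀ z ∈ coreSites d R, z ∉ gpiVolume' d R' := fun z hz => not_mem_gpiVolume'_of_mem_coreSites hz
  have hpiece := isingExpect_fixed_piecewise_eq_div (zdGraph d) β (baseBC d s)
    (fun y => p (halfSite d y)) (coreSites d R) hZ hfm hf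
  have hT : ∀ σ : SpinConfig (Site d), ∏ z ∈ coreSites d R,
      Real.exp (β * (((((p (halfSite d z)) : ℤ) : ℝ) - (((baseBC d s z) : ℤ) : ℝ)) *
        nbrSum (zdGraph d) (gpiVolume' d R') z σ)) = coreTilt d β p R σ := by
    intro σ
    unfold coreTilt
    refine Finset.prod_congr rfl fun z hz => ?_
    have hz1 : baseBC d s z = 1 := by simp [baseBC, (mem_coreSites_iff.1 hz).1]
    rw [hz1, nbrSum_gpiVolume'_eq hR hz]
    simp
  rw [phaseBC_eq_piecewise, hpiece]
  simp only [hT]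

/-- **Step 2.2 for `⟨R;∞;p;+⟩` from Step 2.2 for the all-`+` image system** ("changing the
image spins inside `Λ_R` amounts to a finite-volume perturbation of the system and hence it does
not alter the number of Gibbs measures", §4.3.1 Step 2.2, in finite volume): granted
`VEFS1993_step22`, for every pattern `p`, every `R` and every bounded observable `f` of finitely
many internal spins, the `+` and `-` finite-volume states of `⟨R;∞;p;+⟩` (boundary conditions
`phaseBC d p R 1`, `phaseBC d p R (-1)`) give `f` the same limit:
`⟨f⟩^{+}_{Λ^int_{R'}} - ⟨f⟩^{-}_{Λ^int_{R'}} → 0`. Proof: both are ratios `⟨fT⟩^{±}/⟨T⟩^{±}` in the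
all-`+` image system (`isingExpect_phaseBC_eq_div`); the differences `⟨fT⟩⁺ - ⟨fT⟩⁻`,
`⟨T⟩⁺ - ⟨T⟩⁻` are controlled by the one-point differences at finitely many internal sites
(`abs_isingExpect_fixed_sub_le_sum`, FKG), which tend to `0` by `VEFS1993_step22`.
[cite: VanenterFernandezSokal1993, §4.3.1 Step 2.2] -/
theorem tendsto_isingExpect_phaseBC_sub (h22 : VEFS1993_step22) (hd : 3 ≤ d) {β : ℝ} (hβ : 0 ≤ β)
    (p : Site d → ℤˣ) (R : ℕ) {f : SpinConfig (Site d) → ℝ} {D : Finset (Site d)}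
    (hfD : DependsOn f (↑D : Set (Site d))) (hD : ∀ y ∈ D, ¬IsDecimatedSite d y) :
    Tendsto (fun R' : ℕ =>
      isingExpect (zdGraph d) (gpiVolume' d R') β 0 (.fixed (phaseBC d p R 1)) f -
        isingExpect (zdGraph d) (gpiVolume' d R') β 0 (.fixed (phaseBC d p R (-1))) f)
      atTop (𝓝 0) := by
  classical
  have hfm : Measurable f := DependsOn.measurable_of_finset D hfD
  obtain ⟨M, hM⟩ := DependsOn.exists_bound_of_finset D hfD
  -- the support of `f T`
  set D' : Finset (Site d) := D ∪ (coreSites d R).biUnion fun z => (zdGraph d).neighborFinset z with hD'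
  have hD'int : ∀ y ∈ D', ¬IsDecimatedSite d y := by
    intro y hy
    rcases Finset.mem_union.1 hy with hy | hy
    · exact hD y hy
    · obtain ⟨z, hz, hyz⟩ := Finset.mem_biUnion.1 hy
      exact not_isDecimatedSite_of_adj (mem_coreSites_iff.1 hz).1
        ((SimpleGraph.mem_neighborFinset _ _ _).1 hyz)
  -- eventually `D ⊆ Λ^int_{R'}`
  obtain ⟨L₀, hL₀⟩ := exists_forall_subset_box d D
  set N₀ : ℕ := max (R + 1) L₀ with hN₀
  have hDsub : ∀ R', N₀ ≤ R' → ∀ x ∈ D, x ∈ gpiVolume' d R' := by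
    intro R' hR' x hx
    rw [mem_gpiVolume'_iff]
    refine ⟨box_mono d (by omega) (hL₀ R' ((le_max_right _ _).trans hR') hx), hD x hx⟩
  -- the tilt and its bounds
  set T := coreTilt d β p R with hTdef
  set K := coreTiltExp d β R with hK
  have hTm : Measurable T := measurable_coreTilt β p R
  have hTdep : DependsOn T (↑D' : Set (Site d)) := fun σ τ h =>
    dependsOn_coreTilt (d := d) β p R fun x hx => h x (by
      rw [hD', Finset.coe_union]; exact Or.inr hx)
  set mT := Real.exp (-K) with hmT
  set MT := Real.exp K with hMT
  have hmTpos : 0 < mT := Real.exp_pos _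
  have hTbd : ∀ σ, mT ≤ T σ ∧ T σ ≤ MT := fun σ => coreTilt_mem_Icc β p R σ
  have hM0 : 0 ≤ M := (abs_nonneg _).trans (hM (fun _ => 1))
  -- the four sequences
  set A : ℤˣ → ℕ → ℝ := fun s R' =>
    isingExpect (zdGraph d) (gpiVolume' d R') β 0 (.fixed (baseBC d s)) (fun σ => f σ * T σ) with hA
  set B : ℤˣ → ℕ → ℝ := fun s R' =>
    isingExpect (zdGraph d) (gpiVolume' d R') β 0 (.fixed (baseBC d s)) T with hB
  have hfTm : Measurable fun σ => f σ * T σ := hfm.mul hTm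
  have hfTdep : DependsOn (fun σ => f σ * T σ) (↑D' : Set (Site d)) := by
    intro σ τ h
    simp only
    rw [hfD fun x hx => h x (by rw [hD', Finset.coe_union]; exact Or.inl hx), hTdep h]
  have hfTbd : ∀ σ, |f σ * T σ| ≤ M * MT := fun σ => by
    rw [abs_mul, abs_of_pos (coreTilt_pos β p R σ)]
    exact mul_le_mul (hM σ) (hTbd σ).2 (coreTilt_pos β p R σ).le hM0
  have hTbd' : ∀ σ, |T σ| ≤ MT := fun σ => by
    rw [abs_of_pos (coreTilt_pos β p R σ)]; exact (hTbd σ).2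
  have hBge : ∀ s R', mT ≤ B s R' := fun s R' => by
    calc mT = isingExpect (zdGraph d) (gpiVolume' d R') β 0 (.fixed (baseBC d s)) (fun _ => mT) :=
          (isingExpect_const _ _ _ _ _ _).symm
      _ ≤ B s R' := isingExpect_mono_fun (zdGraph d) _ β 0 _ measurable_const hTm fun σ => (hTbd σ).1
  have hBle : ∀ s R', |B s R'| ≤ MT := fun s R' => by
    rw [abs_of_pos (hmTpos.trans_le (hBge s R'))]
    calc B s R' ≤ isingExpect (zdGraph d) (gpiVolume' d R') β 0 (.fixed (baseBC d s)) (fun _ => MT) :=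
          isingExpect_mono_fun (zdGraph d) _ β 0 _ hTm measurable_const fun σ => (hTbd σ).2
      _ = MT := isingExpect_const _ _ _ _ _ _
  have hAle : ∀ s R', |A s R'| ≤ M * MT := fun s R' => by
    have := norm_isingExpect_le (zdGraph d) (gpiVolume' d R') β 0 (.fixed (baseBC d s))
      (f := fun σ => f σ * T σ) (C := M * MT) fun σ => by
        rw [Real.norm_eq_abs]; exact hfTbd σ
    simpa only [Real.norm_eq_abs] using this
  -- one-point differences at the finitely many internal sites of `D'` tend to zero
  set δ : ℕ → ℝ := fun R' => ∑ x ∈ D',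
    (isingExpect (zdGraph d) (gpiVolume' d R') β 0 (.fixed (baseBC d 1)) (spinAt x) -
      isingExpect (zdGraph d) (gpiVolume' d R') β 0 (.fixed (baseBC d (-1))) (spinAt x)) with hδ
  have hδ0 : Tendsto δ atTop (𝓝 0) := by
    have := tendsto_finsetSum D' fun x hx => h22 d hd β hβ x (hD'int x hx)
    simpa only [Finset.sum_const_zero] using this
  -- FKG control of the two differences
  have hAdiff : ∀ R', |A 1 R' - A (-1) R'| ≤ M * MT * δ R' := fun R' =>
    abs_isingExpect_fixed_sub_le_sum (zdGraph d) hβ (gpiVolume' d R') 0 baseBC_neg_one_le_one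
      hfTm hfTdep hfTbd
  have hBdiff : ∀ R', |B 1 R' - B (-1) R'| ≤ MT * δ R' := fun R' =>
    abs_isingExpect_fixed_sub_le_sum (zdGraph d) hβ (gpiVolume' d R') 0 baseBC_neg_one_le_one
      hTm hTdep hTbd'
  -- the ratio identities, eventually
  have hratio : ∀ R', N₀ ≤ R' → ∀ s : ℤˣ,
      isingExpect (zdGraph d) (gpiVolume' d R') β 0 (.fixed (phaseBC d p R s)) f = A s R' / B s R' := by
    intro R' hR' s
    exact isingExpect_phaseBC_eq_div β p ((le_max_left _ _).trans hR') s hfm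
      fun σ σ' h => hfD fun x hx => h x (hDsub R' hR' x hx)
  -- squeeze
  have hbound : ∀ R', N₀ ≤ R' →
      |isingExpect (zdGraph d) (gpiVolume' d R') β 0 (.fixed (phaseBC d p R 1)) f -
        isingExpect (zdGraph d) (gpiVolume' d R') β 0 (.fixed (phaseBC d p R (-1))) f| ≤
        (M * MT * MT + M * MT * MT) * δ R' / mT ^ 2 := by
    intro R' hR'
    rw [hratio R' hR' 1, hratio R' hR' (-1)]
    refine (abs_div_sub_div_le_of_le hmTpos (hBge 1 R') (hBge (-1) R') (hAle (-1) R')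
      (hBle (-1) R')).trans ?_
    refine div_le_div_of_nonneg_right ?_ (by positivity)
    have h1 := hAdiff R'
    have h2 := hBdiff R'
    have hMT0 : 0 ≤ MT := (Real.exp_pos _).le
    nlinarith [mul_le_mul_of_nonneg_right h1 hMT0, mul_le_mul_of_nonneg_left h2 (mul_nonneg hM0 hMT0)]
  have hlim : Tendsto (fun R' => (M * MT * MT + M * MT * MT) * δ R' / mT ^ 2) atTop (𝓝 0) := by
    have := (hδ0.const_mul (M * MT * MT + M * MT * MT)).div_const (mT ^ 2)
    simpa using this
  refine squeeze_zero_norm' ?_ hlim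
  filter_upwards [eventually_ge_atTop N₀] with R' hR'
  rw [Real.norm_eq_abs]
  exact hbound R' hR'

end Literature.Barriers.CriticalPhenomena.NonGibbs


/-! ## The extremal systems of (4.26)–(4.27) are `-` states of `⟨R;∞;±Σ;+⟩`; assembly of Step 2 -/

namespace Literature.Barriers.CriticalPhenomena.NonGibbs

open MeasureTheory Finset Filter Topology Literature.Probability.LatticeModels

variable {d : ℕ}

/-- An image site on the outer boundary of `Λ^int_{R'}` has its half in `Λ_{R'}` (the image spins
outside `Λ_{R'}` are invisible to the internal-spin system in `Λ^int_{R'}`).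
[cite: VanenterFernandezSokal1993, §4.3.1 Step 2.1 ("the DLR equations … are identical")] -/
theorem halfSite_mem_box_of_mem_outerBoundary {R' : ℕ} {y : Site d}
    (hy : y ∈ outerBoundary (zdGraph d) (gpiVolume' d R')) (himg : IsDecimatedSite d y) :
    halfSite d y ∈ box d R' := by
  obtain ⟨-, x, hx, hxy⟩ := mem_outerBoundary_iff.1 hy
  exact halfSite_mem_box_of_adj (mem_gpiVolume'_iff.1 hx).1 hxy.symm himg

/-- **The extremal system of (4.26) is the `-` state of `⟨R;∞;Σ;+⟩` in `Λ^int_{R'}`**: the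
boundary conditions `coreAnnulusBC d 2 R R' 1 (-1)` and `phaseBC d ω'_alt R (-1)` agree on the
outer boundary of `Λ^int_{R'}` (they differ only at image sites outside `Λ_{R'}`), so they define the
same finite-volume expectations of observables of `Λ^int_{R'}` (§4.3.1 Step 2.1: "for any volume
`Λ ⊆ Λ_{R'-1}`, the DLR equations for the systems `⟨R,R';Σ,+,σ⟩` and `⟨R;∞;Σ;+⟩` are identical").
[cite: VanenterFernandezSokal1993, §4.3.1 Step 2.1] -/
theorem isingExpect_coreAnnulusBC_eq_phaseBC (β : ℝ) (R R' : ℕ) {f : SpinConfig (Site d) → ℝ}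
    (hfm : Measurable f)
    (hf : ∀ σ σ' : SpinConfig (Site d), (∀ x ∈ gpiVolume' d R', σ x = σ' x) → f σ = f σ') :
    isingExpect (zdGraph d) (gpiVolume' d R') β 0 (.fixed (coreAnnulusBC d 2 R R' 1 (-1))) f =
      isingExpect (zdGraph d) (gpiVolume' d R') β 0 (.fixed (phaseBC d (altConfig d) R (-1))) f := by
  classical
  refine isingExpect_fixed_congr_outerBoundary (zdGraph d) (fun y hy => ?_) β 0 hfm hf
  by_cases himg : IsDecimatedSite d y
  · have hbox := halfSite_mem_box_of_mem_outerBoundary hy himg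
    rw [coreAnnulusBC_apply_dec R R' 1 (-1) himg]
    change (if halfSite d y ∈ box d R then altConfig d (halfSite d y)
      else if halfSite d y ∈ box d R' then (1 : ℤˣ) else -1) = phaseBC d (altConfig d) R (-1) y
    simp only [phaseBC, himg, if_true, hbox]
  · rw [coreAnnulusBC_apply_internal R R' 1 (-1) himg, phaseBC_of_not_isDecimatedSite _ _ _ himg]

/-- **The flipped extremal system of (4.27) is the `-` state of `⟨R;∞;-Σ;+⟩` in `Λ^int_{R'}`**:
`-coreAnnulusBC d 2 R R' (-1) 1` and `phaseBC d (-ω'_alt) R (-1)` agree on the outer boundary of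
`Λ^int_{R'}` ("by symmetry", (4.27); footnote 48). [cite: VanenterFernandezSokal1993, §4.3.1 Step 2.1 and eq. (4.27)] -/
theorem isingExpect_neg_coreAnnulusBC_eq_phaseBC (β : ℝ) (R R' : ℕ) {f : SpinConfig (Site d) → ℝ}
    (hfm : Measurable f)
    (hf : ∀ σ σ' : SpinConfig (Site d), (∀ x ∈ gpiVolume' d R', σ x = σ' x) → f σ = f σ') :
    isingExpect (zdGraph d) (gpiVolume' d R') β 0 (.fixed (-coreAnnulusBC d 2 R R' (-1) 1)) f =
      isingExpect (zdGraph d) (gpiVolume' d R') β 0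
        (.fixed (phaseBC d (fun x => -altConfig d x) R (-1))) f := by
  classical
  refine isingExpect_fixed_congr_outerBoundary (zdGraph d) (fun y hy => ?_) β 0 hfm hf
  rw [Pi.neg_apply]
  by_cases himg : IsDecimatedSite d y
  · have hbox := halfSite_mem_box_of_mem_outerBoundary hy himg
    rw [coreAnnulusBC_apply_dec R R' (-1) 1 himg]
    change -(if halfSite d y ∈ box d R then altConfig d (halfSite d y)
      else if halfSite d y ∈ box d R' then (-1 : ℤˣ) else 1) =
        phaseBC d (fun x => -altConfig d x) R (-1) y
    simp only [phaseBC, himg, if_true, hbox]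
    split_ifs <;> simp
  · rw [coreAnnulusBC_apply_internal R R' (-1) 1 himg, phaseBC_of_not_isDecimatedSite _ _ _ himg]

/-! ### Step 2 (phase selection) from Step 2.2 (uniqueness) -/

/-- **Phase selection for one pattern**: granted `VEFS1993_step22`, for an alternating pattern `p`,
an increasing local observable `f` of internal spins, `R` and `ε > 0`, there is `N` with
`⟨f⟩⁺_{dec;Λ^int_L} - ε ≤ ⟨f⟩^{phaseBC p R (-1)}_{Λ^int_{R'}}` for all `R', L ≥ N` (Steps 2.1–2.3 in finite
volume: the `-` states of `⟨R;∞;p;+⟩` increase with the volume, the `+` states decrease and dominate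
the decorated `+` states — `patternBC p ≤ phaseBC p R 1`, the fields of the pattern cancel —, the
decorated `+` states decrease to the `+` phase, and the `±` states of `⟨R;∞;p;+⟩` merge by Step 2.2).
[cite: VanenterFernandezSokal1993, §4.3.1 Steps 2.1–2.3] -/
theorem exists_forall_sub_le_isingExpect_phaseBC (h22 : VEFS1993_step22) (hd : 3 ≤ d) {β : ℝ}
    (hβ : 0 ≤ β) {p : Site d → ℤˣ} (hp : IsAlternating p) {f : SpinConfig (Site d) → ℝ}
    (hf : Monotone f) {D : Finset (Site d)} (hD : ∀ y ∈ D, ¬IsDecimatedSite d y)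
    (hfD : DependsOn f (↑D : Set (Site d))) (R : ℕ) {ε : ℝ} (hε : 0 < ε) :
    ∃ N : ℕ, ∀ R' L : ℕ, N ≤ R' → N ≤ L →
      isingExpect (decoratedGraph d) (gpiVolume' d L) β 0 .plus f - ε ≤
        isingExpect (zdGraph d) (gpiVolume' d R') β 0 (.fixed (phaseBC d p R (-1))) f := by
  have hfm : Measurable f := DependsOn.measurable_of_finset D hfD
  obtain ⟨C, hC⟩ := DependsOn.exists_bound_of_finset D hfD
  -- eventually `D ⊆ Λ^int_{R'}`
  obtain ⟨L₀, hL₀⟩ := exists_forall_subset_box d D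
  have hDsub : ∀ R', L₀ ≤ R' → ∀ x ∈ D, x ∈ gpiVolume' d R' := fun R' hR' x hx =>
    mem_gpiVolume'_iff.2 ⟨box_mono d (by omega) (hL₀ R' hR' hx), hD x hx⟩
  -- the sequences
  set gm : ℕ → ℝ := fun R' =>
    isingExpect (zdGraph d) (gpiVolume' d R') β 0 (.fixed (phaseBC d p R (-1))) f with hgm
  set gp : ℕ → ℝ := fun R' =>
    isingExpect (zdGraph d) (gpiVolume' d R') β 0 (.fixed (phaseBC d p R 1)) f with hgp
  set a : ℕ → ℝ := fun L => isingExpect (decoratedGraph d) (gpiVolume' d L) β 0 .plus f with ha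
  -- (Step 2.2) the `±` states of `⟨R;∞;p;+⟩` merge
  have huniq : Tendsto (fun R' => gp R' - gm R') atTop (𝓝 0) :=
    tendsto_isingExpect_phaseBC_sub h22 hd hβ p R hfD hD
  obtain ⟨N₁, hN₁⟩ := Metric.tendsto_atTop.1 huniq (ε / 3) (by positivity)
  -- (Step 2.3, finite volume) the `+` states dominate the decorated `+` states
  have hgp_ge : ∀ R', L₀ ≤ R' → a R' ≤ gp R' := by
    intro R' hR'
    have hint : ∀ y ∈ gpiVolume' d R', ¬IsDecimatedSite d y := fun y hy => not_isDecimatedSite_of_mem_gpiVolume' hy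
    have hloc : ∀ σ σ' : SpinConfig (Site d), (∀ x ∈ gpiVolume' d R', σ x = σ' x) → f σ = f σ' :=
      fun σ σ' h => hfD fun x hx => h x (hDsub R' hR' x hx)
    calc a R' = isingExpect (zdGraph d) (gpiVolume' d R') β 0 (.fixed (patternBC d p)) f :=
          (isingExpect_patternBC_eq_decorated hp hint β hfm hloc).symm
      _ ≤ gp R' := isingExpect_fixed_mono (zdGraph d) hβ _ 0 (patternBC_le_phaseBC_one p R) hf hfm
  -- the decorated `+` states decrease with the volume, hence converge
  have hanti : Antitone a := fun L L' hLL' =>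
    isingExpect_fixed_anti_volume (decoratedGraph d) hβ (gpiVolume'_mono hLL') 0 (η := 1)
      (fun _ _ => rfl) hf hfm
  have hbdd : BddBelow (Set.range a) := ⟨-C, by
    rintro _ ⟨L, rfl⟩
    have h1 := norm_isingExpect_le (decoratedGraph d) (gpiVolume' d L) β 0 .plus (f := f) (C := C)
      fun σ => by rw [Real.norm_eq_abs]; exact hC σ
    rw [Real.norm_eq_abs] at h1
    have h2 := neg_abs_le (a L)
    change -C ≤ a L
    linarith⟩
  have hconv : Tendsto a atTop (𝓝 (⨅ L, a L)) := tendsto_atTop_ciInf hanti hbdd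
  obtain ⟨N₂, hN₂⟩ := Metric.tendsto_atTop.1 hconv (ε / 3) (by positivity)
  refine ⟨max (max N₁ N₂) L₀, fun R' L hR' hL => ?_⟩
  have hR'₁ : N₁ ≤ R' := (le_max_left _ _).trans ((le_max_left _ _).trans hR')
  have hR'₂ : N₂ ≤ R' := (le_max_right _ _).trans ((le_max_left _ _).trans hR')
  have hL₂ : N₂ ≤ L := (le_max_right _ _).trans ((le_max_left _ _).trans hL)
  have hR'₀ : L₀ ≤ R' := (le_max_right _ _).trans hR'
  have h1 := hN₁ R' hR'₁
  have h2 := hN₂ R' hR'₂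
  have h3 := hN₂ L hL₂
  rw [Real.dist_eq] at h1 h2 h3
  have h4 := hgp_ge R' hR'₀
  change a L - ε ≤ gm R'
  have := abs_lt.1 h1
  have := abs_lt.1 h2
  have := abs_lt.1 h3
  linarith

/-- **Step 2 (phase selection) from Step 2.2 (uniqueness for the all-`+` image system)**:
`VEFS1993_step22 → VEFS1993_step2`. The extremal system of (4.26) and the flip of that of (4.27)
are the `-` states of `⟨R;∞;±Σ;+⟩` in `Λ^int_{R'}` (the image spins outside `Λ_{R'}` being
invisible), and `ω'_alt`, `-ω'_alt` are both alternating patterns, so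
`exists_forall_sub_le_isingExpect_phaseBC` applies to each. What remains for `VEFS1993_step2`, and
hence (with `VEFS1993_step24_holds`) for Theorem 4.2, is the uniqueness statement
`VEFS1993_step22`. [cite: VanenterFernandezSokal1993, §4.3.1 Steps 2.1–2.3 and eq. (4.27)] -/
theorem VEFS1993_step2_of_step22 (h22 : VEFS1993_step22) : VEFS1993_step2 := by
  intro d hd β hβ f hf D hD hfD R ε hε
  have hβ0 : 0 ≤ β := (criticalBeta_nonneg (d - 1)).trans hβ.le
  have hfm : Measurable f := DependsOn.measurable_of_finset D hfD
  have hD' : ∀ y ∈ D, ¬IsDecimatedSite d y := hD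
  obtain ⟨L₀, hL₀⟩ := exists_forall_subset_box d D
  have hloc : ∀ R', L₀ ≤ R' → ∀ σ σ' : SpinConfig (Site d),
      (∀ x ∈ gpiVolume' d R', σ x = σ' x) → f σ = f σ' := fun R' hR' σ σ' h =>
    hfD fun x hx => h x (mem_gpiVolume'_iff.2 ⟨box_mono d (by omega) (hL₀ R' hR' hx), hD x hx⟩)
  obtain ⟨Np, hNp⟩ := exists_forall_sub_le_isingExpect_phaseBC h22 hd hβ0 isAlternating_altConfig
    hf hD' hfD R hε
  obtain ⟨Nn, hNn⟩ := exists_forall_sub_le_isingExpect_phaseBC h22 hd hβ0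
    isAlternating_neg_altConfig hf hD' hfD R hε
  refine ⟨max (max Np Nn) L₀, fun R' L hR' hL => ⟨?_, ?_⟩⟩
  · rw [isingExpect_coreAnnulusBC_eq_phaseBC β R R' hfm (hloc R' ((le_max_right _ _).trans hR'))]
    exact hNp R' L ((le_max_left _ _).trans ((le_max_left _ _).trans hR'))
      ((le_max_left _ _).trans ((le_max_left _ _).trans hL))
  · rw [isingExpect_neg_coreAnnulusBC_eq_phaseBC β R R' hfm (hloc R' ((le_max_right _ _).trans hR'))]
    exact hNn R' L ((le_max_right _ _).trans ((le_max_left _ _).trans hR'))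
      ((le_max_right _ _).trans ((le_max_left _ _).trans hL))

/-- **Theorem 4.2 from the uniqueness statement alone**: `VEFS1993_step22 → VEFS1993_thm42`
(Step 2 from Step 2.2, proved here; Step 2.4 proved in `…Step24.lean`; (4.12), Step 3, (4.32) and
the conclusion proved before). [cite: VanenterFernandezSokal1993, Theorem 4.2] -/
theorem VEFS1993_thm42_of_step22 (h22 : VEFS1993_step22) : VEFS1993_thm42 :=
  VEFS1993_thm42_of_step2 (VEFS1993_step2_of_step22 h22) VEFS1993_step24_holds

/-- The barrier from the uniqueness statement. [cite: VanenterFernandezSokal1993, Theorem 4.2] -/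
theorem positionSpaceRGNonGibbsian_of_step22 (h22 : VEFS1993_step22) : PositionSpaceRGNonGibbsian :=
  positionSpaceRGNonGibbsian_of_step2 (VEFS1993_step2_of_step22 h22) VEFS1993_step24_holds

end Literature.Barriers.CriticalPhenomena.NonGibbs

end
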